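import Literature.NumberTheory.EllipticCurves.BinaryQuarticBadReductionSolubilityProofs
import Literature.NumberTheory.EllipticCurves.BhargavaShankarWeightHalfProofs
import HarnessLib

/-!
# Bhargava–Shankar, Prop. 5.13 / Prop. 3.18 assembled: "if `f ∈ V_{ℤ_p}` is bad at `p` then
# `p² ∣ Δ(f)`" (`p ≥ 5`), and its contrapositive

`Proofs` companion (theorems only: no definitions, no named facts) assembling
`BinaryQuarticBadReductionSolubilityProofs` (`BinaryQuartic.sq_dvd_disc_of_not_isSoluble`: the
solubility half) and `BhargavaShankarWeightHalfProofs`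
(`BinaryQuartic.sq_dvd_disc_of_twist_integral_of_not_scalar_mul_integral`: the weight half).

Source. M. Bhargava, A. Shankar, *Binary quartic forms having bounded invariants, and the
boundedness of the average rank of elliptic curves*, Ann. of Math. (2) 181 (2015) 191–242, §5.3 of
the held arXiv text `arXiv:1006.1002v2`: *"We say that an element `f ∈ V_ℤ` is bad at `p` if either
`f` is not `ℚ_p`-soluble or there exists an element `f' ∈ V_ℤ` such that `f` is
`PGL₂(ℚ_p)`-equivalent to `f'` but not `PGL₂(ℤ_p)`-equivalent to `f'`"*, and the proof of
Prop. 5.13 (= Prop. 3.18 of the published version, whose conclusion reads "then `p² ∣ Δ(f)`").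
With `PGL₂(K)`-equivalence realised by the twisted action `γ · f = (det γ)⁻² f((x,y)γ)`
(`BinaryQuartic.twist`), this file records:

* `BinaryQuartic.sq_dvd_disc_of_bad` — **for a prime `p ≥ 5` and `f ∈ V_{ℤ_p}`: if `f` is not
  `ℚ_p`-soluble, or some `γ ∈ GL₂(ℚ_p) ∖ ℚ_pˣ·GL₂(ℤ_p)` carries `f` to an integral form, then
  `p² ∣ Δ(f)`** (the second alternative contains both "`PGL₂(ℚ_p)`- but not
  `PGL₂(ℤ_p)`-equivalent to an integral `f'`" and "a `ℚ_p`-automorphism of `f` outside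
  `PGL₂(ℤ_p)`", i.e. `m_p(f) ≠ 1` in the published version);
* `BinaryQuartic.good_at_of_not_sq_dvd_disc` — the contrapositive as used by the sieve: if
  `p² ∤ Δ(f)` then `f` is `ℚ_p`-soluble, every `γ ∈ GL₂(ℚ_p)` with `γ · f` integral lies in
  `ℚ_pˣ · GL₂(ℤ_p)`, and in particular every integral form `PGL₂(ℚ_p)`-equivalent to `f` is
  `PGL₂(ℤ_p)`-equivalent to it.

## References

* M. Bhargava, A. Shankar, Ann. of Math. (2) 181 (2015) 191–242 = arXiv:1006.1002, §5.3 and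
  Prop. 5.13 of the arXiv v2 text (Prop. 3.18 of the published version).
  [cite: BhargavaShankarAnnals2015, Prop. 5.13 (arXiv:1006.1002v2 numbering)]
-/

noncomputable section

open scoped Classical

namespace Literature.NumberTheory.EllipticCurves

namespace BinaryQuartic

variable {p : ℕ} [Fact p.Prime]

/-- **Bhargava–Shankar, Prop. 5.13 / Prop. 3.18: bad at `p` implies `p² ∣ Δ(f)`** (`p ≥ 5`).
[cite: BhargavaShankarAnnals2015, Prop. 5.13 (arXiv:1006.1002v2 numbering)] -/
theorem sq_dvd_disc_of_bad (hp : 5 ≤ p) (f : BinaryQuartic ℤ_[p])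
    (hbad : ¬ (f.map PadicInt.Coe.ringHom).IsSoluble ∨
      ∃ (γ : Matrix (Fin 2) (Fin 2) ℚ_[p]) (f' : BinaryQuartic ℤ_[p]), γ.det ≠ 0 ∧
        twist γ (f.map PadicInt.Coe.ringHom) = f'.map PadicInt.Coe.ringHom ∧
        ¬ ∃ (c : ℚ_[p]) (k : Matrix (Fin 2) (Fin 2) ℤ_[p]), c ≠ 0 ∧ IsUnit k.det ∧
          γ = c • k.map PadicInt.Coe.ringHom) :
    (p : ℤ_[p]) ^ 2 ∣ f.disc := by
  rcases hbad with hsol | ⟨γ, f', hγ, h, hnot⟩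
  · exact sq_dvd_disc_of_not_isSoluble hp hsol
  · exact sq_dvd_disc_of_twist_integral_of_not_scalar_mul_integral f f' hγ h hnot

/-- **`p² ∤ Δ(f)` implies that `f` is good at `p`** (`p ≥ 5`): `f` is `ℚ_p`-soluble, every
`γ ∈ GL₂(ℚ_p)` carrying `f` to an integral form lies in `ℚ_pˣ · GL₂(ℤ_p)` (so `ℚ_p`-automorphisms
of `f` come from `GL₂(ℤ_p)`), and every integral form `PGL₂(ℚ_p)`-equivalent to `f` is
`PGL₂(ℤ_p)`-equivalent to it. [cite: BhargavaShankarAnnals2015, Prop. 5.13 (arXiv:1006.1002v2 numbering)] -/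
theorem good_at_of_not_sq_dvd_disc (hp : 5 ≤ p) (f : BinaryQuartic ℤ_[p])
    (hΔ : ¬ (p : ℤ_[p]) ^ 2 ∣ f.disc) :
    (f.map PadicInt.Coe.ringHom).IsSoluble ∧
    (∀ (γ : Matrix (Fin 2) (Fin 2) ℚ_[p]) (f' : BinaryQuartic ℤ_[p]), γ.det ≠ 0 →
      twist γ (f.map PadicInt.Coe.ringHom) = f'.map PadicInt.Coe.ringHom →
      ∃ (c : ℚ_[p]) (k : Matrix (Fin 2) (Fin 2) ℤ_[p]), c ≠ 0 ∧ IsUnit k.det ∧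
        γ = c • k.map PadicInt.Coe.ringHom) ∧
    (∀ (γ : Matrix (Fin 2) (Fin 2) ℚ_[p]) (f' : BinaryQuartic ℤ_[p]), γ.det ≠ 0 →
      twist γ (f.map PadicInt.Coe.ringHom) = f'.map PadicInt.Coe.ringHom →
      ∃ k : Matrix (Fin 2) (Fin 2) ℤ_[p], IsUnit k.det ∧
        twist (k.map PadicInt.Coe.ringHom) (f.map PadicInt.Coe.ringHom)
          = f'.map PadicInt.Coe.ringHom) := by
  refine ⟨isSoluble_coe_of_not_sq_dvd_disc hp f hΔ, fun γ f' hγ h ↦ ?_, fun γ f' hγ h ↦ ?_⟩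
  · by_contra hnot
    exact hΔ (sq_dvd_disc_of_twist_integral_of_not_scalar_mul_integral f f' hγ h hnot)
  · exact exists_integral_twist_of_not_sq_dvd_disc f f' hΔ hγ h

/-- `p² ∣ Δ` in `ℤ_p` for an integral form means `p² ∣ Δ` in `ℤ`. [folklore] -/
theorem sq_dvd_disc_int_of_padicInt {f : BinaryQuartic ℤ}
    (h : (p : ℤ_[p]) ^ 2 ∣ (f.map (Int.castRingHom ℤ_[p])).disc) : (p : ℤ) ^ 2 ∣ f.disc := by
  rw [disc_map, eq_intCast] at h
  have h' : ‖((f.disc : ℤ) : ℤ_[p])‖ ≤ (p : ℝ) ^ (-(2 : ℕ) : ℤ) := by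
    rw [PadicInt.norm_le_pow_iff_mem_span_pow, Ideal.mem_span_singleton]; exact h
  exact PadicInt.norm_int_le_pow_iff_dvd.mp h'

/-- **Prop. 5.13 / Prop. 3.18 for integral forms, as in the source (`f, f' ∈ V_ℤ`):** if `p ≥ 5`
and `f ∈ V_ℤ` is bad at `p` — not `ℚ_p`-soluble, or `PGL₂(ℚ_p)`-equivalent but not
`PGL₂(ℤ_p)`-equivalent to some `f' ∈ V_ℤ` — then `p² ∣ Δ(f)`.
[cite: BhargavaShankarAnnals2015, Prop. 5.13 (arXiv:1006.1002v2 numbering)] -/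
theorem sq_dvd_disc_int_of_bad (hp : 5 ≤ p) (f : BinaryQuartic ℤ)
    (hbad : ¬ (f.map (Int.castRingHom ℚ_[p])).IsSoluble ∨
      ∃ (γ : Matrix (Fin 2) (Fin 2) ℚ_[p]) (f' : BinaryQuartic ℤ), γ.det ≠ 0 ∧
        twist γ (f.map (Int.castRingHom ℚ_[p])) = f'.map (Int.castRingHom ℚ_[p]) ∧
        ¬ ∃ k : Matrix (Fin 2) (Fin 2) ℤ_[p], IsUnit k.det ∧
          twist (k.map PadicInt.Coe.ringHom) (f.map (Int.castRingHom ℚ_[p]))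
            = f'.map (Int.castRingHom ℚ_[p])) :
    (p : ℤ) ^ 2 ∣ f.disc := by
  apply sq_dvd_disc_int_of_padicInt
  rcases hbad with hsol | ⟨γ, f', hγ, h, hnot⟩
  · apply sq_dvd_disc_of_not_isSoluble hp
    rwa [map_intCast_map_coe]
  · apply sq_dvd_disc_of_pgl2Q_equiv_not_pgl2Z_equiv _ (f'.map (Int.castRingHom ℤ_[p])) hγ
    · rw [map_intCast_map_coe, map_intCast_map_coe]; exact h
    · rw [map_intCast_map_coe, map_intCast_map_coe]; exact hnot

end BinaryQuartic

end Literature.NumberTheory.EllipticCurves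

end
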